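import Summits.BirchSwinnertonDyer.BirchSwinnertonDyer.Theorems.CyclotomicUntwistSigmaLineFamilyHeightDatum
import Literature.NumberTheory.EllipticCurves.CanonicalPAdicHeightAdmissibleProofs
import Literature.NumberTheory.EllipticCurves.PadicPointsFiniteIndexProofs
import Mathlib.GroupTheory.OrderOfElement
import HarnessLib

/-!
# Route `CyclotomicUntwist`, crux K1 `PSRankOneLowerHalfAtThree` (stmt-BirchSwinnertonDyer-21580):
# the σ-LINE FAMILY — deep admissible multiples exist, and a `p`-adic height datum is DETERMINED by its
# quadratic form on the deep admissible locus; hence THE `σ_c`-height datum exists uniquely (`∃!`)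

Cell `pub/bsd-wall` (D-0145 line `route-BirchSwinnertonDyer-CyclotomicUntwist`), seat `bsd-line-cycu-p1`
g4 (K1 base). THEOREMS ONLY (no definition, no named fact, no `sorry`); helper `--supports` K1 =
stmt-BirchSwinnertonDyer-21580. Sequel of `…SigmaLineFamilyHeightDatum.lean`. BSD is not proved by this
file and nothing here is evidence for or against K1/K2.

* `exists_deep_admissible_nsmul` — for `W/ℚ` globally minimal, ANY prime `p`, every non-torsion
  `P ∈ E(ℚ)` has a multiple `m • P = (x, y)`, `m ≠ 0`, with `‖x‖_p > 1`, `‖z‖_p ≤ p⁻³` and non-singular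
  reduction at every prime (tree `exists_admissible_nsmul_holds`, then the index of the formal filtration
  `E⁽³⁾` — `finiteIndex_formalFiltration`, `AddSubgroup.nsmul_index_mem` — and the subgroups
  `nonsingularReductionSubgroupAt`).
* `heightDatum_ext_of_deep` — two `PAdicHeightData W p` agreeing on the self-pairings of deep admissible
  points are EQUAL (tree `PAdicHeightData.ext_of_sq_eq_on`).
* `heightDatum_formalSigma_unique`, **`existsUnique_heightDatum_formalSigma`** — for `p` odd, `c ∈ ℤ_p`:
  `∃! D : PAdicHeightData W p` with `D(P,P) = h_{σ_c}(P)` (`CensusX42.sigmaHeight`) on the deep admissible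
  locus. So «the `σ_c`-height pairing of `E/ℚ` at `p`» is a well-defined invariant for every member of the
  formal sigma family and every reduction type — the object the route's D5 refers to (via
  `c ↦ D_{c₀} + (c − c₀)·L`, `…SigmaLineFamilyLineData.lean`).

References: Mazur–Stein–Tate 2006 §1 ("extends uniquely to the full Mordell–Weil group"); Silverman AEC
VII.2.2, VII.6.1, VII.6.3; Mazur–Tate–Teitelbaum 1986 §II.4. [cite: MazurSteinTate2006, §2.7]
[cite: SilvermanAEC2009, VII.6.3]
-/

set_option autoImplicit false
-- single-conjunct summit: `Summit.BirchSwinnertonDyer.BirchSwinnertonDyer.…` repeats the name by design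
set_option linter.dupNamespace false

noncomputable section

open scoped Classical

open PowerSeries WeierstrassCurve Literature.NumberTheory.EllipticCurves
  Summit.BirchSwinnertonDyer.Rank1Residual.Additive
  Summit.BirchSwinnertonDyer.BirchSwinnertonDyer.Theorems.PSSigmaLineFamilyHeightDatum

namespace Summit.BirchSwinnertonDyer.BirchSwinnertonDyer.Theorems.PSSigmaLineFamilyHeightDatumUnique

variable {p : ℕ} [Fact p.Prime] (W : WeierstrassCurve ℚ) [W.IsElliptic] [W.IsGloballyMinimal]

/-- **Every non-torsion rational point has a DEEP ADMISSIBLE multiple**: `m • P = (x, y)` with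
`‖x‖_p > 1`, `‖z‖_p ≤ p⁻³` and non-singular reduction at every prime, for some `m ≠ 0` (an admissible
multiple, tree `exists_admissible_nsmul_holds`, pushed into `E⁽³⁾` by the finite index of the formal
filtration, tree `finiteIndex_formalFiltration`). [Silverman AEC VII.2.2, VII.6.3; Mazur–Stein–Tate 2006, §1]
[cite: SilvermanAEC2009, VII.6.3] -/
theorem exists_deep_admissible_nsmul (P : W.toAffine.Point) (hP : ¬ IsOfFinAddOrder P) :
    ∃ m : ℕ, m ≠ 0 ∧ ∃ (x y : ℚ) (h : W.toAffine.Nonsingular x y), m • P = .some x y h ∧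
      1 < ‖(x : ℚ_[p])‖ ∧ ‖(-(x : ℚ_[p]) / (y : ℚ_[p]))‖ ≤ ((p : ℝ)⁻¹) ^ 3 ∧
        ∀ ℓ : ℕ, ℓ.Prime → W.HasNonsingularReductionAt ℓ x y := by
  set V := W.baseChange ℚ_[p] with hVdef
  obtain ⟨m₁, hm₁, hadm⟩ := exists_admissible_nsmul_holds W p P hP
  set Q := m₁ • P with hQdef
  set F := V.formalFiltration 3 with hFdef
  haveI : F.FiniteIndex := V.finiteIndex_formalFiltration 3
  set n := F.index with hndef
  have hn : n ≠ 0 := AddSubgroup.FiniteIndex.index_ne_zero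
  refine ⟨n * m₁, mul_ne_zero hn hm₁, ?_⟩
  -- the admissible point `Q` and its multiple `n • Q`
  obtain ⟨hQtor, hQloc⟩ := hadm
  rcases hQ : Q with _ | ⟨x, y, h⟩
  · rw [hQ] at hQloc; exact (W.not_satisfiesLocalConditions_zero p hQloc).elim
  rw [hQ] at hQloc
  obtain ⟨hx, -, hns⟩ := hQloc
  -- `ι Q ∈ E₁`, hence `n • ι Q ∈ E⁽³⁾`
  have hιQ : W.toPadicPoint p (.some x y h) = .some (x : ℚ_[p]) (y : ℚ_[p]) (nonsingular_ratCast h) :=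
    toPadicPoint_some h
  have hmemF : W.toPadicPoint p (n • (.some x y h : W.toAffine.Point)) ∈ F := by
    rw [map_nsmul]
    exact F.nsmul_index_mem _
  -- the multiple is non-zero
  have hR0 : n • (.some x y h : W.toAffine.Point) ≠ 0 := by
    intro h0
    apply hP
    rw [isOfFinAddOrder_iff_nsmul_eq_zero]
    refine ⟨n * m₁, Nat.pos_of_ne_zero (mul_ne_zero hn hm₁), ?_⟩
    rw [mul_nsmul', ← hQdef, hQ, h0]
  rcases hR : n • (.some x y h : W.toAffine.Point) with _ | ⟨x', y', h'⟩
  · exact (hR0 hR).elim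
  refine ⟨x', y', h', by rw [mul_nsmul', ← hQdef, hQ, hR], ?_, ?_, ?_⟩
  · rw [hR, toPadicPoint_some h'] at hmemF
    exact ((V.mem_formalFiltration_iff).mp hmemF).1
  · rw [hR, toPadicPoint_some h'] at hmemF
    exact ((V.mem_formalFiltration_iff).mp hmemF).2
  · intro ℓ hℓ
    haveI : Fact ℓ.Prime := ⟨hℓ⟩
    have hQmem : (.some x y h : W.toAffine.Point) ∈ W.nonsingularReductionSubgroupAt ℓ :=
      (mem_nonsingularReductionSubgroupAt_iff _).mpr (hns ℓ hℓ)
    have := AddSubgroup.nsmul_mem _ hQmem n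
    rw [hR] at this
    exact (mem_nonsingularReductionSubgroupAt_iff _).mp this

/-- **UNIQUENESS: a height datum is determined by its quadratic form on the deep admissible locus.** Two
`PAdicHeightData W p` whose self-pairings agree at every deep admissible rational point are EQUAL (tree
`PAdicHeightData.ext_of_sq_eq_on` + `exists_deep_admissible_nsmul`). In particular the `σ_c`-height datum of
`exists_heightDatum_formalSigma` is unique: «the» `σ_c`-height pairing of `E/ℚ` at `p` is well defined for
every `c ∈ ℤ_p` and every reduction type. [Mazur–Stein–Tate 2006, §1 ("extends uniquely")]
[cite: MazurSteinTate2006, §2.7] -/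
theorem heightDatum_ext_of_deep {D₁ D₂ : PAdicHeightData W p}
    (h : ∀ {x y : ℚ} (hxy : W.toAffine.Nonsingular x y),
      1 < ‖(x : ℚ_[p])‖ → ‖(-(x : ℚ_[p]) / (y : ℚ_[p]))‖ ≤ ((p : ℝ)⁻¹) ^ 3 →
        (∀ ℓ : ℕ, ℓ.Prime → W.HasNonsingularReductionAt ℓ x y) →
          D₁.pairing (.some x y hxy) (.some x y hxy) = D₂.pairing (.some x y hxy) (.some x y hxy)) :
    D₁ = D₂ := by
  refine PAdicHeightData.ext_of_sq_eq_on
    {Q : W.toAffine.Point | ∃ (x y : ℚ) (hxy : W.toAffine.Nonsingular x y), Q = .some x y hxy ∧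
      1 < ‖(x : ℚ_[p])‖ ∧ ‖(-(x : ℚ_[p]) / (y : ℚ_[p]))‖ ≤ ((p : ℝ)⁻¹) ^ 3 ∧
        ∀ ℓ : ℕ, ℓ.Prime → W.HasNonsingularReductionAt ℓ x y} ?_ ?_
  · intro P hP
    obtain ⟨m, hm, x, y, hxy, hmP, hx, hz, hns⟩ := exists_deep_admissible_nsmul W (p := p) P hP
    exact ⟨m, hm, x, y, hxy, hmP, hx, hz, hns⟩
  · rintro Q ⟨x, y, hxy, rfl, hx, hz, hns⟩
    exact h hxy hx hz hns

/-- **THE σ_c-HEIGHT DATUM IS UNIQUE** (`p` odd, `c ∈ ℤ_p`): any two data with quadratic form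
`h_{σ_c}` on the deep admissible locus coincide. [cite: MazurSteinTate2006, §2.7] -/
theorem heightDatum_formalSigma_unique {c : ℚ_[p]} {D₁ D₂ : PAdicHeightData W p}
    (h₁ : ∀ {x y : ℚ} (hxy : W.toAffine.Nonsingular x y),
      1 < ‖(x : ℚ_[p])‖ → ‖(-(x : ℚ_[p]) / (y : ℚ_[p]))‖ ≤ ((p : ℝ)⁻¹) ^ 3 →
        (∀ ℓ : ℕ, ℓ.Prime → W.HasNonsingularReductionAt ℓ x y) →
          D₁.pairing (.some x y hxy) (.some x y hxy) =
            CensusX42.sigmaHeight W p ((W.baseChange ℚ_[p]).formalSigma c) (.some x y hxy))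
    (h₂ : ∀ {x y : ℚ} (hxy : W.toAffine.Nonsingular x y),
      1 < ‖(x : ℚ_[p])‖ → ‖(-(x : ℚ_[p]) / (y : ℚ_[p]))‖ ≤ ((p : ℝ)⁻¹) ^ 3 →
        (∀ ℓ : ℕ, ℓ.Prime → W.HasNonsingularReductionAt ℓ x y) →
          D₂.pairing (.some x y hxy) (.some x y hxy) =
            CensusX42.sigmaHeight W p ((W.baseChange ℚ_[p]).formalSigma c) (.some x y hxy)) :
    D₁ = D₂ :=
  heightDatum_ext_of_deep W fun hxy hx hz hns => by rw [h₁ hxy hx hz hns, h₂ hxy hx hz hns]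

/-- **∃! form**: for `p` odd and `c ∈ ℤ_p` there is EXACTLY ONE `PAdicHeightData W p` with quadratic form
`h_{σ_c}` on the deep admissible locus. [cite: MazurSteinTate2006, §2.7] -/
theorem existsUnique_heightDatum_formalSigma (hp3 : 3 ≤ p) {c : ℚ_[p]} (hc : ‖c‖ ≤ 1) :
    ∃! D : PAdicHeightData W p, ∀ {x y : ℚ} (hxy : W.toAffine.Nonsingular x y),
      1 < ‖(x : ℚ_[p])‖ → ‖(-(x : ℚ_[p]) / (y : ℚ_[p]))‖ ≤ ((p : ℝ)⁻¹) ^ 3 →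
        (∀ ℓ : ℕ, ℓ.Prime → W.HasNonsingularReductionAt ℓ x y) →
          D.pairing (.some x y hxy) (.some x y hxy) =
            CensusX42.sigmaHeight W p ((W.baseChange ℚ_[p]).formalSigma c) (.some x y hxy) := by
  obtain ⟨D, hD⟩ := exists_heightDatum_formalSigma W hp3 hc
  exact ⟨D, fun hxy hx hz hns => hD hxy hx hz hns, fun D' hD' =>
    heightDatum_formalSigma_unique W (fun hxy hx hz hns => hD' hxy hx hz hns) (fun hxy hx hz hns => hD hxy hx hz hns)⟩

end Summit.BirchSwinnertonDyer.BirchSwinnertonDyer.Theorems.PSSigmaLineFamilyHeightDatumUnique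

end
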